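import Literature.MathematicalPhysics.QuantumFieldTheory.MullerSchiemann1987.MS87RecursionCoefficients
import HarnessLib

/-!
# Müller–Schiemann, *Continuum limit of a hierarchical SU(2) lattice gauge theory in 4 dimensions*
# (CMP 110, 1987), Sect. 6 p.278 L.27–29 «the transformation (6.2) has a unique inverse» — THE EXISTENCE HALF:
# every `(β̂, λ̂, σ̂)` of the weak-coupling range is attained by (6.2) from a point of the weak-coupling domain, with an
# explicit threshold `β̂ ≥ 600(1 + Λ)²` — PROVED by a compactness ∕ descent argument (theorems only; no definition,
# no named fact)

statement-level skeleton of published theorems with citation tags; proofs where landed; nothing here is a claim about the Yang–Mills mass gap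

[MullerSchiemann1987] V. F. Müller, J. Schiemann, Commun. Math. Phys. **110** (1987) 261–286, Sect. 6 p.278, (6.2)–(6.3).
Read by this seat on its own 3× page render of the journal scan (`renders-cmp110ms/`, p.278 = PDF 18). Lean lane of
the lit-balaban YM LIT SWEEP CONTEXT row X1 (register `MullerSchiemann1987/`); the model is the `d = 4` HIERARCHICAL
`SU(2)` gauge model (Migdal's recursion), NOT lattice Yang–Mills. Siblings: `MS87RecursionCoefficients` (defines (6.2):
`hatβ`, `hatlam`, `σ̂ = σ`; certifies the printed inverse (6.3) to printed order; declares «existence and uniqueness of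
the inverse MAP on the domain — NOT claimed») and `MS87DecouplingMapInjective` (the UNIQUENESS half, `eq62_injective`,
and (6.2) in the variable `u = λ/β`: `hatβ_of_mul`, `hatlam_of_mul`). THIS FILE PROVES THE EXISTENCE HALF, so that with
the sibling «(6.2) has a unique inverse» on the weak-coupling domain is in the tree (for an explicit, crude threshold).

**What the paper prints (p.278).** *«β̂ := β + (5/3)λβ^{−1} − (5/27)λβ^{−2} − (31/9)λ²β^{−3} + (35/9)σβ^{−2},
λ̂ := λ + 7/270 − (11/3)λ²β^{−2} + (14/3)σβ^{−1}, σ̂ := σ, (6.2) … We observe that within the weak coupling domain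
considered, i.e. β ≧ β̲ (large enough) and |λβ^{−1}|, |σβ^{−1}| bounded by constants, the transformation (6.2) has a
unique inverse, β = β̂ − (5/3)λ̂β̂^{−1} + 𝒪(β̂^{−1}), λ = λ̂ − 7/270 + (11/3)λ̂²β̂^{−2} − (14/3)σ̂β̂^{−1} + 𝒪(β̂^{−1}),
σ = σ̂. (6.3)»*

**What this file proves (kernel-checked, 0 sorry, standard axioms; theorems only, no definition, no named fact).**
* `G_lipschitz`: the correction `G = (β̂ − β, λ̂ − λ)` of (6.2) is Lipschitz-small on the weak-coupling domain —
  for `βᵢ ≥ β̲ ≥ 1`, `|λᵢ| ≤ Λβᵢ`, `|σ| ≤ Λβ₁`: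
  `|ΔG_λ| + |ΔG_β| ≤ (2 + 29Λ + 18Λ²)(|Δλ| + |Δβ|)/β̲` (the estimate behind the sibling's `core_estimate`).
* `G_size`: at one point of the domain `|β̂ − β| ≤ (5/3)L + 1`, `|λ̂ − λ − 7/270| ≤ (11/3)L² + (14/3)L` once
  `L ≥ |λ|/β, |σ|/β` and `β ≥ (5/27)L + (31/9)L² + (35/9)L` (the box is mapped into itself by the correction step).
* **`eq62_surjective` (EXISTENCE OF THE INVERSE)**: for `Λ ≥ 0`, `|λ̂| ≤ Λβ̂`, `|σ| ≤ Λβ̂` and **`β̂ ≥ 600(1 + Λ)²`**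
  there are `β ≥ β̂/2` and `λ` with `|λ| ≤ (2Λ + 1)β` such that `β̂(β, λ, σ) = β̂`, `λ̂(β, λ, σ) = λ̂` (and `σ̂ = σ`).
  Route (no fixed-point machinery): on the compact box `D = [β̂ − R, β̂ + R] × [λ̂ − 7/270 − R_λ, λ̂ − 7/270 + R_λ]`
  (`R = (5/3)(2Λ+1) + 1`, `R_λ = (11/3)(2Λ+1)² + (14/3)(2Λ+1)`) the continuous defect
  `F(β, λ) = |β̂(β, λ, σ) − β̂| + |λ̂(β, λ, σ) − λ̂|` attains its minimum at some `x`; the corrected point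
  `x′ = (β̂ − G_β(x), λ̂ − G_λ(x))` lies in `D` again and `F(x′) = |ΔG_β| + |ΔG_λ| ≤ ½F(x)` by `G_lipschitz`, so the
  minimum is `0`.

**Readings / scope (declared).** (i) The threshold `600(1 + Λ)²` and the box are crude explicit renderings of «β̲ large
enough»; the print's constants bounding `|λβ^{−1}|, |σβ^{−1}|` are the letter `Λ` (the preimage is found with
`|λ| ≤ (2Λ + 1)β`). (ii) Uniqueness is the sibling's `eq62_injective`; the `r = 4` analogue of (6.2) is not addressed.

**Not claimed.** (6.3) beyond the sibling's certification, Proposition 2, Theorem 1, anything about lattice Yang–Mills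
or the Clay problem.
-/

open Set

namespace Literature.MathematicalPhysics.QuantumFieldTheory

namespace MullerSchiemann1987

namespace DecouplingMapInverse

open RecursionCoefficients (hatβ hatlam)

/-- (6.2) in the variable `u = λ/β` (as in the sibling `DecouplingMapInjective.hatlam_of_mul`, restated with the
substitution as a hypothesis to keep this file's import closure at `MS87RecursionCoefficients`).
[cite: MullerSchiemann1987, (6.2) p.278] -/
private theorem hatlam_subst {β lam u : ℝ} (hβ : β ≠ 0) (h : lam = u * β) (σ : ℝ) :
    hatlam β lam σ = u * β + 7 / 270 - 11 / 3 * u ^ 2 + 14 / 3 * σ / β := by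
  subst h
  simp only [hatlam]
  field_simp

/-- (6.2) in the variable `u = λ/β`, `β̂`-component. [cite: MullerSchiemann1987, (6.2) p.278] -/
private theorem hatβ_subst {β lam u : ℝ} (hβ : β ≠ 0) (h : lam = u * β) (σ : ℝ) :
    hatβ β lam σ = β + 5 / 3 * u - 5 / 27 * u / β - 31 / 9 * u ^ 2 / β + 35 / 9 * σ / β ^ 2 := by
  subst h
  simp only [hatβ]
  field_simp

/-- `|a/b| ≤ A/b₀` from `|a| ≤ A`, `0 < b₀ ≤ b`. [folklore] -/
private theorem abs_div_le {a b A b₀ : ℝ} (ha : |a| ≤ A) (hb₀ : 0 < b₀) (hb : b₀ ≤ b) : |a / b| ≤ A / b₀ := by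
  have hb' : 0 < b := lt_of_lt_of_le hb₀ hb
  rw [abs_div, abs_of_pos hb']
  exact div_le_div₀ ((abs_nonneg a).trans ha) ha hb₀ hb

/-! ## §1 The correction of (6.2) is Lipschitz-small on the weak-coupling domain -/

/-- **`G = (β̂ − β, λ̂ − λ)` is Lipschitz with constant `(2 + 29Λ + 18Λ²)/β̲`** (in the `ℓ¹` sense) on
`{β ≥ β̲ ≥ 1, |λ| ≤ Λβ}` (`|σ| ≤ Λβ₁`): `|ΔG_λ| + |ΔG_β| ≤ (2 + 29Λ + 18Λ²)(|Δλ| + |Δβ|)/β̲`.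
[cite: MullerSchiemann1987, (6.2)–(6.3) p.278] -/
theorem G_lipschitz {β₁ β₂ lam₁ lam₂ s β₀ Λ : ℝ} (hβ₀ : 1 ≤ β₀) (h₁ : β₀ ≤ β₁) (h₂ : β₀ ≤ β₂)
    (hl₁ : |lam₁| ≤ Λ * β₁) (hl₂ : |lam₂| ≤ Λ * β₂) (hs₁ : |s| ≤ Λ * β₁) :
    |(hatlam β₁ lam₁ s - lam₁) - (hatlam β₂ lam₂ s - lam₂)| + |(hatβ β₁ lam₁ s - β₁) - (hatβ β₂ lam₂ s - β₂)| ≤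
      (2 + 29 * Λ + 18 * Λ ^ 2) * (|lam₁ - lam₂| + |β₁ - β₂|) / β₀ := by
  have hβ₀0 : 0 < β₀ := by linarith
  have hb₁ : 0 < β₁ := by linarith
  have hb₂ : 0 < β₂ := by linarith
  -- pass to `uᵢ = λᵢ/βᵢ`
  set u₁ := lam₁ / β₁ with hu₁d
  set u₂ := lam₂ / β₂ with hu₂d
  have el₁ : lam₁ = u₁ * β₁ := by rw [hu₁d]; field_simp
  have el₂ : lam₂ = u₂ * β₂ := by rw [hu₂d]; field_simp
  have hu₁ : |u₁| ≤ Λ := by rw [hu₁d, abs_div, abs_of_pos hb₁, div_le_iff₀ hb₁]; exact hl₁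
  have hu₂ : |u₂| ≤ Λ := by rw [hu₂d, abs_div, abs_of_pos hb₂, div_le_iff₀ hb₂]; exact hl₂
  have hΛ : 0 ≤ Λ := (abs_nonneg _).trans hu₁
  have h12 : β₀ ≤ β₁ * β₂ := h₁.trans (le_mul_of_one_le_right hb₁.le (by linarith))
  have h22 : β₀ ≤ β₂ ^ 2 := by
    rw [sq]; exact h₂.trans (le_mul_of_one_le_right hb₂.le (by linarith))
  have eX : lam₁ - lam₂ = u₁ * β₁ - u₂ * β₂ := by rw [el₁, el₂]
  rw [eX]
  set X := |u₁ * β₁ - u₂ * β₂| with hX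
  set Y := |β₁ - β₂| with hY
  have hX0 : 0 ≤ X := abs_nonneg _
  have hY0 : 0 ≤ Y := abs_nonneg _
  -- the two differences in closed form
  have eL : (hatlam β₁ lam₁ s - lam₁) - (hatlam β₂ lam₂ s - lam₂) =
      -(11 / 3 * (u₁ ^ 2 - u₂ ^ 2) - 14 / 3 * s * (1 / β₁ - 1 / β₂)) := by
    rw [hatlam_subst hb₁.ne' el₁, hatlam_subst hb₂.ne' el₂, el₁, el₂]; ring
  have eB : (hatβ β₁ lam₁ s - β₁) - (hatβ β₂ lam₂ s - β₂) =
      -(-(5 / 3) * (u₁ - u₂) + 5 / 27 * (u₁ / β₁ - u₂ / β₂) + 31 / 9 * (u₁ ^ 2 / β₁ - u₂ ^ 2 / β₂)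
        - 35 / 9 * s * (1 / β₁ ^ 2 - 1 / β₂ ^ 2)) := by
    rw [hatβ_subst hb₁.ne' el₁, hatβ_subst hb₂.ne' el₂]; ring
  rw [eL, eB, abs_neg, abs_neg]
  -- `Δu = (Δλ − u₂Δβ)/β₁`, `|Δu| ≤ (X + ΛY)/β̲`
  have dU : u₁ - u₂ = ((u₁ * β₁ - u₂ * β₂) - u₂ * (β₁ - β₂)) / β₁ := by field_simp; ring
  have aU : |u₁ - u₂| ≤ (X + Λ * Y) / β₀ := by
    rw [dU]
    refine abs_div_le ?_ hβ₀0 h₁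
    calc |(u₁ * β₁ - u₂ * β₂) - u₂ * (β₁ - β₂)| ≤ |u₁ * β₁ - u₂ * β₂| + |u₂ * (β₁ - β₂)| := abs_sub _ _
      _ ≤ X + Λ * Y := by rw [abs_mul]; exact add_le_add le_rfl (mul_le_mul_of_nonneg_right hu₂ (abs_nonneg _))
  have hU0 : 0 ≤ |u₁ - u₂| := abs_nonneg _
  -- the λ-part
  have tL1 : |11 / 3 * (u₁ ^ 2 - u₂ ^ 2)| ≤ 22 / 3 * Λ * |u₁ - u₂| := by
    rw [show u₁ ^ 2 - u₂ ^ 2 = (u₁ - u₂) * (u₁ + u₂) by ring, abs_mul, abs_mul,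
      abs_of_pos (by norm_num : (0:ℝ) < 11 / 3)]
    have h2 : |u₁ + u₂| ≤ 2 * Λ := (abs_add_le _ _).trans (by linarith)
    have := mul_le_mul_of_nonneg_left h2 hU0
    linarith
  have tL2 : |14 / 3 * s * (1 / β₁ - 1 / β₂)| ≤ 14 / 3 * Λ * Y / β₀ := by
    have e : 14 / 3 * s * (1 / β₁ - 1 / β₂) = 14 / 3 * (s / β₁) * ((β₂ - β₁) / β₂) := by
      field_simp
    rw [e, abs_mul, abs_mul, abs_of_pos (by norm_num : (0:ℝ) < 14 / 3)]
    have a1 : |s / β₁| ≤ Λ := by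
      rw [abs_div, abs_of_pos hb₁, div_le_iff₀ hb₁]; exact hs₁
    have a2 : |(β₂ - β₁) / β₂| ≤ Y / β₀ := abs_div_le (by rw [abs_sub_comm]) hβ₀0 h₂
    calc 14 / 3 * |s / β₁| * |(β₂ - β₁) / β₂| ≤ 14 / 3 * Λ * (Y / β₀) :=
          mul_le_mul (mul_le_mul_of_nonneg_left a1 (by norm_num)) a2 (abs_nonneg _) (by positivity)
      _ = _ := by ring
  have hPb : |11 / 3 * (u₁ ^ 2 - u₂ ^ 2) - 14 / 3 * s * (1 / β₁ - 1 / β₂)| ≤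
      22 / 3 * Λ * |u₁ - u₂| + 14 / 3 * Λ * Y / β₀ :=
    (abs_sub _ _).trans (add_le_add tL1 tL2)
  -- the β-part
  have tB1 : |-(5 / 3) * (u₁ - u₂)| = 5 / 3 * |u₁ - u₂| := by
    rw [abs_mul, abs_neg, abs_of_pos (by norm_num : (0:ℝ) < 5 / 3)]
  have tB2 : |5 / 27 * (u₁ / β₁ - u₂ / β₂)| ≤ 5 / 27 * (|u₁ - u₂| + Λ * Y / β₀) := by
    rw [abs_mul, abs_of_pos (by norm_num : (0:ℝ) < 5 / 27)]
    refine mul_le_mul_of_nonneg_left ?_ (by norm_num)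
    have e : u₁ / β₁ - u₂ / β₂ = (u₁ - u₂) / β₁ + u₂ * ((β₂ - β₁) / (β₁ * β₂)) := by field_simp; ring
    rw [e]
    refine (abs_add_le _ _).trans (add_le_add ?_ ?_)
    · have := abs_div_le (le_rfl : |u₁ - u₂| ≤ |u₁ - u₂|) hβ₀0 h₁
      exact this.trans (div_le_self hU0 hβ₀)
    · rw [abs_mul]
      have a2 : |(β₂ - β₁) / (β₁ * β₂)| ≤ Y / β₀ := abs_div_le (by rw [abs_sub_comm]) hβ₀0 h12
      calc |u₂| * |(β₂ - β₁) / (β₁ * β₂)| ≤ Λ * (Y / β₀) := mul_le_mul hu₂ a2 (abs_nonneg _) hΛ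
        _ = _ := by ring
  have tB3 : |31 / 9 * (u₁ ^ 2 / β₁ - u₂ ^ 2 / β₂)| ≤ 31 / 9 * (2 * Λ * |u₁ - u₂| + Λ ^ 2 * Y / β₀) := by
    rw [abs_mul, abs_of_pos (by norm_num : (0:ℝ) < 31 / 9)]
    refine mul_le_mul_of_nonneg_left ?_ (by norm_num)
    have e : u₁ ^ 2 / β₁ - u₂ ^ 2 / β₂ = (u₁ - u₂) * (u₁ + u₂) / β₁ + u₂ ^ 2 * ((β₂ - β₁) / (β₁ * β₂)) := by
      field_simp; ring
    rw [e]
    refine (abs_add_le _ _).trans (add_le_add ?_ ?_)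
    · have hnum : |(u₁ - u₂) * (u₁ + u₂)| ≤ 2 * Λ * |u₁ - u₂| := by
        rw [abs_mul]
        have h2 : |u₁ + u₂| ≤ 2 * Λ := (abs_add_le _ _).trans (by linarith)
        have := mul_le_mul_of_nonneg_left h2 hU0
        linarith
      have := abs_div_le hnum hβ₀0 h₁
      exact this.trans (div_le_self (by positivity) hβ₀)
    · rw [abs_mul, abs_pow, sq_abs]
      have a2 : |(β₂ - β₁) / (β₁ * β₂)| ≤ Y / β₀ := abs_div_le (by rw [abs_sub_comm]) hβ₀0 h12
      have hu2sq : u₂ ^ 2 ≤ Λ ^ 2 := sq_le_sq' (abs_le.mp hu₂).1 (abs_le.mp hu₂).2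
      calc u₂ ^ 2 * |(β₂ - β₁) / (β₁ * β₂)| ≤ Λ ^ 2 * (Y / β₀) := mul_le_mul hu2sq a2 (abs_nonneg _) (sq_nonneg _)
        _ = _ := by ring
  have tB4 : |35 / 9 * s * (1 / β₁ ^ 2 - 1 / β₂ ^ 2)| ≤ 70 / 9 * Λ * Y / β₀ := by
    have e : 35 / 9 * s * (1 / β₁ ^ 2 - 1 / β₂ ^ 2) =
        35 / 9 * (s / β₁) * ((β₂ - β₁) / β₂ ^ 2 + (β₂ - β₁) / (β₁ * β₂)) := by
      field_simp; ring
    rw [e, abs_mul, abs_mul, abs_of_pos (by norm_num : (0:ℝ) < 35 / 9)]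
    have a1 : |s / β₁| ≤ Λ := by
      rw [abs_div, abs_of_pos hb₁, div_le_iff₀ hb₁]; exact hs₁
    have a2 : |(β₂ - β₁) / β₂ ^ 2 + (β₂ - β₁) / (β₁ * β₂)| ≤ 2 * (Y / β₀) := by
      refine (abs_add_le _ _).trans ?_
      have b1 : |(β₂ - β₁) / β₂ ^ 2| ≤ Y / β₀ := abs_div_le (by rw [abs_sub_comm]) hβ₀0 h22
      have b2 : |(β₂ - β₁) / (β₁ * β₂)| ≤ Y / β₀ := abs_div_le (by rw [abs_sub_comm]) hβ₀0 h12
      linarith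
    calc 35 / 9 * |s / β₁| * |(β₂ - β₁) / β₂ ^ 2 + (β₂ - β₁) / (β₁ * β₂)| ≤ 35 / 9 * Λ * (2 * (Y / β₀)) :=
          mul_le_mul (mul_le_mul_of_nonneg_left a1 (by norm_num)) a2 (abs_nonneg _) (by positivity)
      _ = _ := by ring
  have hQb : |-(5 / 3) * (u₁ - u₂) + 5 / 27 * (u₁ / β₁ - u₂ / β₂) + 31 / 9 * (u₁ ^ 2 / β₁ - u₂ ^ 2 / β₂)
        - 35 / 9 * s * (1 / β₁ ^ 2 - 1 / β₂ ^ 2)| ≤ 5 / 3 * |u₁ - u₂| + 5 / 27 * (|u₁ - u₂| + Λ * Y / β₀) +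
      31 / 9 * (2 * Λ * |u₁ - u₂| + Λ ^ 2 * Y / β₀) + 70 / 9 * Λ * Y / β₀ := by
    refine (abs_sub _ _).trans ?_
    refine (add_le_add ((abs_add_le _ _).trans (add_le_add ((abs_add_le _ _).trans (add_le_add le_rfl tB2)) tB3)) tB4).trans ?_
    rw [tB1]
  -- assemble
  have hK : |11 / 3 * (u₁ ^ 2 - u₂ ^ 2) - 14 / 3 * s * (1 / β₁ - 1 / β₂)| +
      |-(5 / 3) * (u₁ - u₂) + 5 / 27 * (u₁ / β₁ - u₂ / β₂) + 31 / 9 * (u₁ ^ 2 / β₁ - u₂ ^ 2 / β₂)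
        - 35 / 9 * s * (1 / β₁ ^ 2 - 1 / β₂ ^ 2)| ≤
      (50 / 27 + 128 / 9 * Λ) * |u₁ - u₂| + (14 / 3 * Λ + 215 / 27 * Λ + 31 / 9 * Λ ^ 2) * Y / β₀ := by
    have e : (14 / 3 * Λ + 215 / 27 * Λ + 31 / 9 * Λ ^ 2) * Y / β₀ =
        14 / 3 * Λ * Y / β₀ + 5 / 27 * (Λ * Y / β₀) + 31 / 9 * (Λ ^ 2 * Y / β₀) + 70 / 9 * Λ * Y / β₀ := by ring
    rw [e]; linarith
  have hk₁ : 0 ≤ 50 / 27 + 128 / 9 * Λ := by positivity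
  have step : (50 / 27 + 128 / 9 * Λ) * |u₁ - u₂| ≤ (50 / 27 + 128 / 9 * Λ) * ((X + Λ * Y) / β₀) :=
    mul_le_mul_of_nonneg_left aU hk₁
  have e2 : (50 / 27 + 128 / 9 * Λ) * ((X + Λ * Y) / β₀) + (14 / 3 * Λ + 215 / 27 * Λ + 31 / 9 * Λ ^ 2) * Y / β₀ =
      ((50 / 27 + 128 / 9 * Λ) * X + (391 / 27 * Λ + 159 / 9 * Λ ^ 2) * Y) / β₀ := by
    field_simp
    ring
  have hfin : |11 / 3 * (u₁ ^ 2 - u₂ ^ 2) - 14 / 3 * s * (1 / β₁ - 1 / β₂)| +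
      |-(5 / 3) * (u₁ - u₂) + 5 / 27 * (u₁ / β₁ - u₂ / β₂) + 31 / 9 * (u₁ ^ 2 / β₁ - u₂ ^ 2 / β₂)
        - 35 / 9 * s * (1 / β₁ ^ 2 - 1 / β₂ ^ 2)| ≤
      ((50 / 27 + 128 / 9 * Λ) * X + (391 / 27 * Λ + 159 / 9 * Λ ^ 2) * Y) / β₀ := by
    rw [← e2]; linarith
  refine hfin.trans (div_le_div_of_nonneg_right ?_ hβ₀0.le)
  have p1 := mul_nonneg hΛ hX0
  have p2 := mul_nonneg hΛ hY0
  have p3 := mul_nonneg (sq_nonneg Λ) hX0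
  have p4 := mul_nonneg (sq_nonneg Λ) hY0
  linarith

/-! ## §2 Existence of the inverse of (6.2) on the weak-coupling range -/

/-- Size of the correction `G = (β̂ − β, λ̂ − λ)` at one point of the domain: with `L ≥ |λ|/β`, `L ≥ |σ|/β` and
`β ≥ (5/27)L + (31/9)L² + (35/9)L`, `β ≥ 1`: `|β̂ − β| ≤ (5/3)L + 1` and `|λ̂ − λ − 7/270| ≤ (11/3)L² + (14/3)L`.
[cite: MullerSchiemann1987, (6.2) p.278] -/
theorem G_size {β lam σ L : ℝ} (hβ1 : 1 ≤ β) (hl : |lam| ≤ L * β) (hσ : |σ| ≤ L * β)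
    (hβL : 5 / 27 * L + 31 / 9 * L ^ 2 + 35 / 9 * L ≤ β) :
    |hatβ β lam σ - β| ≤ 5 / 3 * L + 1 ∧ |hatlam β lam σ - lam - 7 / 270| ≤ 11 / 3 * L ^ 2 + 14 / 3 * L := by
  have hβ : 0 < β := by linarith
  set u := lam / β with hud
  have el : lam = u * β := by rw [hud]; field_simp
  have hu : |u| ≤ L := by rw [hud, abs_div, abs_of_pos hβ, div_le_iff₀ hβ]; exact hl
  have hsβ : |σ / β| ≤ L := by rw [abs_div, abs_of_pos hβ, div_le_iff₀ hβ]; exact hσ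
  have hu2 : u ^ 2 ≤ L ^ 2 := sq_le_sq' (abs_le.mp hu).1 (abs_le.mp hu).2
  rw [hatβ_subst hβ.ne' el, hatlam_subst hβ.ne' el, el]
  constructor
  · have e : β + 5 / 3 * u - 5 / 27 * u / β - 31 / 9 * u ^ 2 / β + 35 / 9 * σ / β ^ 2 - β =
        5 / 3 * u + (-(5 / 27) * u - 31 / 9 * u ^ 2 + 35 / 9 * (σ / β)) / β := by
      field_simp
      ring
    rw [e]
    have hn : |-(5 / 27) * u - 31 / 9 * u ^ 2 + 35 / 9 * (σ / β)| ≤ 5 / 27 * L + 31 / 9 * L ^ 2 + 35 / 9 * L := by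
      refine (abs_add_le _ _).trans ?_
      refine (add_le_add (abs_sub _ _) le_rfl).trans ?_
      rw [abs_mul, abs_neg, abs_of_pos (by norm_num : (0:ℝ) < 5 / 27), abs_mul,
        abs_of_pos (by norm_num : (0:ℝ) < 31 / 9), abs_pow, sq_abs, abs_mul, abs_of_pos (by norm_num : (0:ℝ) < 35 / 9)]
      linarith [mul_le_mul_of_nonneg_left hu (by norm_num : (0:ℝ) ≤ 5 / 27)]
    have hq : |(-(5 / 27) * u - 31 / 9 * u ^ 2 + 35 / 9 * (σ / β)) / β| ≤ 1 := by
      rw [abs_div, abs_of_pos hβ, div_le_one hβ]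
      exact hn.trans hβL
    calc |5 / 3 * u + (-(5 / 27) * u - 31 / 9 * u ^ 2 + 35 / 9 * (σ / β)) / β|
          ≤ |5 / 3 * u| + |(-(5 / 27) * u - 31 / 9 * u ^ 2 + 35 / 9 * (σ / β)) / β| := abs_add_le _ _
      _ ≤ 5 / 3 * L + 1 := by
          rw [abs_mul, abs_of_pos (by norm_num : (0:ℝ) < 5 / 3)]
          linarith [mul_le_mul_of_nonneg_left hu (by norm_num : (0:ℝ) ≤ 5 / 3)]
  · have e : u * β + 7 / 270 - 11 / 3 * u ^ 2 + 14 / 3 * σ / β - u * β - 7 / 270 =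
        -(11 / 3) * u ^ 2 + 14 / 3 * (σ / β) := by ring
    rw [e]
    refine (abs_add_le _ _).trans ?_
    rw [abs_mul, abs_neg, abs_of_pos (by norm_num : (0:ℝ) < 11 / 3), abs_pow, sq_abs, abs_mul,
      abs_of_pos (by norm_num : (0:ℝ) < 14 / 3)]
    linarith

/-- **(6.2) IS ONTO THE WEAK-COUPLING RANGE — EXISTENCE OF THE INVERSE («the transformation (6.2) has a unique
inverse», existence half)**: for `Λ ≥ 0`, `|λ̂| ≤ Λβ̂`, `|σ| ≤ Λβ̂`, `β̂ ≥ 600(1 + Λ)²` there exist `β ≥ β̂/2` and `λ`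
with `|λ| ≤ (2Λ + 1)β`, `β̂(β, λ, σ) = β̂` and `λ̂(β, λ, σ) = λ̂` (`σ̂ = σ`). [cite: MullerSchiemann1987, (6.2)–(6.3) p.278] -/
theorem eq62_surjective {b l σ Λ : ℝ} (hΛ : 0 ≤ Λ) (hl : |l| ≤ Λ * b) (hσ : |σ| ≤ Λ * b)
    (hb : 600 * (1 + Λ) ^ 2 ≤ b) :
    ∃ β lam : ℝ, b / 2 ≤ β ∧ |lam| ≤ (2 * Λ + 1) * β ∧ hatβ β lam σ = b ∧ hatlam β lam σ = l := by
  -- the explicit parameters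
  set L := 2 * Λ + 1 with hLd
  set R := 5 / 3 * L + 1 with hRd
  set Rl := 11 / 3 * L ^ 2 + 14 / 3 * L with hRld
  have hL0 : 0 ≤ L := by rw [hLd]; linarith
  have hR0 : 0 ≤ R := by rw [hRd]; positivity
  have hRl0 : 0 ≤ Rl := by rw [hRld]; positivity
  have hsq : 0 ≤ Λ ^ 2 := sq_nonneg Λ
  have hbR : 2 * R ≤ b := by rw [hRd, hLd]; linarith
  have hbRl : 2 * (1 + Rl) ≤ b := by rw [hRld, hLd]; linarith
  have hbK : 4 * (2 + 29 * L + 18 * L ^ 2) ≤ b := by rw [hLd]; linarith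
  have hbBr : 2 * (5 / 27 * L + 31 / 9 * L ^ 2 + 35 / 9 * L) ≤ b := by rw [hLd]; linarith
  have hb2 : 2 ≤ b := by linarith
  have hb0 : 0 < b := by linarith
  -- the compact box and the facts valid on it
  set D : Set (ℝ × ℝ) := Icc (b - R) (b + R) ×ˢ Icc (l - 7 / 270 - Rl) (l - 7 / 270 + Rl) with hDd
  have hDc : IsCompact D := isCompact_Icc.prod isCompact_Icc
  have hDne : D.Nonempty :=
    ⟨(b, l - 7 / 270), ⟨⟨by linarith, by linarith⟩, ⟨by linarith, by linarith⟩⟩⟩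
  have hDfacts : ∀ p ∈ D, b / 2 ≤ p.1 ∧ 1 ≤ p.1 ∧ |p.2| ≤ L * p.1 ∧ |σ| ≤ L * p.1 := by
    rintro ⟨β, lam⟩ ⟨⟨hβ1, _⟩, ⟨hl1, hl2⟩⟩
    have hβ2 : b / 2 ≤ β := by linarith
    refine ⟨hβ2, by linarith, ?_, ?_⟩
    · have hla : |lam| ≤ |l| + 7 / 270 + Rl := by
        rw [abs_le]; constructor <;> linarith [abs_nonneg l, neg_abs_le l, le_abs_self l]
      have hm := mul_nonneg hΛ (by linarith : (0:ℝ) ≤ β - b / 2)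
      have : Λ * b + 1 + Rl ≤ L * β := by rw [hLd]; linarith
      linarith
    · have hm := mul_nonneg hΛ (by linarith : (0:ℝ) ≤ β - b / 2)
      have hβ0 : 0 ≤ β := by linarith
      have : Λ * b ≤ L * β := by rw [hLd]; linarith
      linarith
  -- the defect `F(β, λ) = |β̂(β, λ, σ) − β̂| + |λ̂(β, λ, σ) − λ̂|`, continuous on `D`
  set F : ℝ × ℝ → ℝ := fun p => |hatβ p.1 p.2 σ - b| + |hatlam p.1 p.2 σ - l| with hFd
  have hFc : ContinuousOn F D := by
    intro p hp
    have hp0 : 0 < p.1 := by linarith [(hDfacts p hp).2.1]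
    have h1 : ContinuousAt (fun q : ℝ × ℝ => hatβ q.1 q.2 σ - b) p := by
      simp only [RecursionCoefficients.hatβ]
      fun_prop (disch := positivity)
    have h2 : ContinuousAt (fun q : ℝ × ℝ => hatlam q.1 q.2 σ - l) p := by
      simp only [RecursionCoefficients.hatlam]
      fun_prop (disch := positivity)
    exact (h1.abs.add h2.abs).continuousWithinAt
  -- a minimiser of the defect
  obtain ⟨x, hxD, hxmin⟩ := hDc.exists_isMinOn hDne hFc
  obtain ⟨hxβ2, hxβ1, hxl, hxσ⟩ := hDfacts x hxD
  have hx0 : 0 < x.1 := by linarith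
  -- the corrected point `x′ = (β̂ − G_β(x), λ̂ − G_λ(x))` lies in `D`
  obtain ⟨gβ, gl⟩ := G_size hxβ1 hxl hxσ (by linarith)
  set x' : ℝ × ℝ := (x.1 - (hatβ x.1 x.2 σ - b), x.2 - (hatlam x.1 x.2 σ - l)) with hx'd
  have hx'D : x' ∈ D := by
    have e1 : x'.1 = b - (hatβ x.1 x.2 σ - x.1) := by simp only [hx'd]; ring
    have e2 : x'.2 = (l - 7 / 270) - (hatlam x.1 x.2 σ - x.2 - 7 / 270) := by simp only [hx'd]; ring
    have a1 := abs_le.mp gβ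
    have a2 := abs_le.mp gl
    refine ⟨⟨?_, ?_⟩, ⟨?_, ?_⟩⟩
    · rw [e1]; linarith
    · rw [e1]; linarith
    · rw [e2]; linarith
    · rw [e2]; linarith
  obtain ⟨hx'β2, hx'β1, hx'l, hx'σ⟩ := hDfacts x' hx'D
  -- `F(x′) = |ΔG_λ| + |ΔG_β| ≤ (2K/b)·F(x) ≤ ½F(x)`
  have hlip := G_lipschitz (β₀ := b / 2) (Λ := L) (by linarith) hx'β2 hxβ2 hx'l hxl hx'σ
  have eFx' : F x' = |(hatlam x'.1 x'.2 σ - x'.2) - (hatlam x.1 x.2 σ - x.2)| +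
      |(hatβ x'.1 x'.2 σ - x'.1) - (hatβ x.1 x.2 σ - x.1)| := by
    have e1 : hatβ x'.1 x'.2 σ - b = (hatβ x'.1 x'.2 σ - x'.1) - (hatβ x.1 x.2 σ - x.1) := by
      simp only [hx'd]; ring
    have e2 : hatlam x'.1 x'.2 σ - l = (hatlam x'.1 x'.2 σ - x'.2) - (hatlam x.1 x.2 σ - x.2) := by
      simp only [hx'd]; ring
    simp only [hFd]
    rw [e1, e2, add_comm]
  have eFx : |x'.2 - x.2| + |x'.1 - x.1| = F x := by
    have e1 : x'.1 - x.1 = -(hatβ x.1 x.2 σ - b) := by simp only [hx'd]; ring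
    have e2 : x'.2 - x.2 = -(hatlam x.1 x.2 σ - l) := by simp only [hx'd]; ring
    simp only [hFd]
    rw [e1, e2, abs_neg, abs_neg, add_comm]
  have hFx0 : 0 ≤ F x := by simp only [hFd]; positivity
  have hcontr : F x' ≤ F x / 2 := by
    rw [eFx']
    refine hlip.trans ?_
    -- `K·F(x)/(β̂/2) ≤ F(x)/2` since `4K ≤ β̂`
    rw [eFx, div_le_iff₀ (by linarith : (0:ℝ) < b / 2)]
    have hm := mul_nonneg hFx0 (by linarith : (0:ℝ) ≤ b / 2 - 2 * (2 + 29 * L + 18 * L ^ 2))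
    linarith
  have hmin : F x ≤ F x' := (isMinOn_iff.mp hxmin) x' hx'D
  have hF0 : F x = 0 := by linarith
  -- read off the solution
  have hsum : |hatβ x.1 x.2 σ - b| + |hatlam x.1 x.2 σ - l| = 0 := by simpa only [hFd] using hF0
  have h1 : |hatβ x.1 x.2 σ - b| = 0 := by linarith [abs_nonneg (hatβ x.1 x.2 σ - b), abs_nonneg (hatlam x.1 x.2 σ - l)]
  have h2 : |hatlam x.1 x.2 σ - l| = 0 := by linarith [abs_nonneg (hatβ x.1 x.2 σ - b), abs_nonneg (hatlam x.1 x.2 σ - l)]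
  rw [abs_eq_zero, sub_eq_zero] at h1 h2
  exact ⟨x.1, x.2, hxβ2, by rw [hLd] at hxl; exact hxl, h1, h2⟩

end DecouplingMapInverse

end MullerSchiemann1987

end Literature.MathematicalPhysics.QuantumFieldTheory
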